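import Literature.AlgebraicGeometry.Milne1999.LefschetzInvolutionIsLefschetz
import HarnessLib

/-!
# `Hg(A^{r+1}) = Hg(A)` acting diagonally (Moonen–Zarhin 1999 §1; Milne 1999 §1), Tannaka-free, on the tree's carriers

Family `hodge`, layer `Literature/AlgebraicGeometry/Milne1999`, namespace `Literature.AlgebraicGeometry.Milne1999` (D-0022).
Theorems only: no definition, no named fact, no `sorry` (D-0026). Written by the seat `ring2-b06` of the cell
`pub-hodge-ring2` (Hodge ladder stage 3; research route conditional on HC_CM; not a corollary; Q11.4-sentence-2 already
refuted in dim ≥ 3) to close the gap recorded in `HodgeTheory/HodgeGroupPowersCentre` ("Not Moonen–Zarhin's identification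
`Hg(A^{k+1}) = Hg(A)` itself (its `⊆ Hg(A)` half needs the transport of Künneth families from the powers of `A^{k+1}` to the
powers of `A`, which the tree does not have)"). The transport is replaced by RETRACTIONS: `A^{a+1}` is a retract of
`(A^{r+1})^{a+1}`, and `(A^{r+1})^{a+1}` is a retract of a power `A^{N+1}`, by homomorphisms of abelian varieties, ALL of which
intertwine the diagonal actions of `u ∈ C(A) ⊗ ℂ` on `H¹` (§2) and hence of `⋀•u` on `H•` (§1); Hodge classes pull back to
Hodge classes, and a retraction is injective on cohomology.

## Sources (held texts, verbatim)

* B. Moonen, Yu. Zarhin, *Hodge classes on abelian varieties of low dimension*, Math. Ann. 315 (1999) [held: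
  `paper:arxiv-math_9901113`, chunk 2 L138–141, as quoted in `HodgeTheory/HodgeGroupPowersCentre`]: "For `n ≥ 1` we can identify
  `Hg(Xⁿ)` with `Hg(X)`, acting diagonally on `V_{Xⁿ} = (V_X)ⁿ`."
* J. S. Milne, *Lefschetz classes on abelian varieties*, Duke Math. J. 96 (1999), §1 p. 643 [held:
  `paper:doi-10-1215-s0012-7094-99-09620-5` p0005 L12–L13]: "For any positive integer `r`, `V(A^r) = rV(A)`, and the diagonal
  action of `C(A)` on `rV(A)` identifies `C(A)` with `C(A^r)`".

## What is proved (`Hg(X)(ℂ) = HodgeTheory.hodgeGroup (dim X) X.X`, Tannaka-free: Künneth families on the powers `X.X^{×(a+1)}`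
fixing the rational `(p,p)`-classes; `Hg(X)(ℂ)|_{H¹} = VanGeemen1994.hodgeGroupOne`; `u^{⊕(r+1)} = Milne1999.diagPow A u r`,
`⋀•(u^{⊕(r+1)}) = Milne1999.diagPowExterior A u r` on `H•(A^{r+1}(ℂ); ℂ)`, `A^{r+1} = A.powSucc r`)

* §1 `exteriorPullback_map_of_intertwine` — `⋀ᵏU_P ∘ f^* = f^* ∘ ⋀ᵏU_Q` on `Hᵏ` as soon as `U_P ∘ f^* = f^* ∘ U_Q` on `H¹`, for a
  homomorphism `f : P → Q` of abelian varieties (both sides are multiplicative on the monomials spanning `Hᵏ = ⋀ᵏH¹`).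
* §2 **Every homomorphism between powers intertwines the diagonal actions of `u ∈ C(A) ⊗ ℂ`** (`diagPow_map_powSucc`,
  `diagPow_map_powSucc_powSucc`, `diagPow_powSucc_map_powSucc`: `A^{m+1} ⇆ A^{n+1}`, `A^{m+1} → (A^{r+1})^{a+1}`,
  `(A^{r+1})^{a+1} → A^{m+1}`) — Milne's "identifies `C(A)` with `C(A^r)`" for rectangular matrices, by induction on the blocks
  (`LefschetzCentraliserPowers` §1/§4).
* §3 Retractions: `A^{a+1}` is a retract of `(A^{r+1})^{a+1}` and `(A^{r+1})^{a+1}` of some `A^{N+1}` (`exists_retraction_…`).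
* §4 `Hg` acts through `H¹` as a family (`hodgeGroup_eq_exteriorPullbackEquiv`, from the tree's `hodgeGroup_apply_cupPowOne`) and its
  Künneth family is `⋀•(g₁^{⊕(a+1)})` (`kunnethFamily_eq_exteriorKunnethFamily_of_mem_hodgeGroup`); transport of "fixes the Hodge
  classes" between `A.X^{×(a+1)}` and `(A^{a+1}).X` (private, by `subst`).
* §5 **MOONEN–ZARHIN, TANNAKA-FREE** (`mem_hodgeGroup_powSucc_iff`): a family `g'` of automorphisms of the `Hᵏ(A^{r+1}(ℂ); ℂ)` lies
  in `hodgeGroup (dim A^{r+1}) (A^{r+1}).X` iff `g' = ⋀•(u^{⊕(r+1)})` for a (unique) `u ∈ Hg(A)(ℂ)|_{H¹} = hodgeGroupOne (dim A) A.X`;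
  on `H¹`: `hodgeGroupOne (dim A^{r+1}) (A^{r+1}).X = {u^{⊕(r+1)} | u ∈ hodgeGroupOne (dim A) A.X}` (`mem_hodgeGroupOne_powSucc_iff`).
  Both halves: `⊇` (`diagPowExterior_mem_hodgeGroup_powSucc`) and the missing `⊆`
  (`exists_mem_hodgeGroupOne_of_mem_hodgeGroup_powSucc`).

## What is NOT here

* Products of distinct factors (`Hg(X₁^{n₁} × ⋯ × X_r^{n_r}) = Hg(X₁ × ⋯ × X_r)`); the Mumford–Tate / similitude version; the
  analogous statements for André's `G¹_mot`, the absolute Hodge stabiliser and the algebraic stabiliser (same proof given the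
  pull-back stability of those classes; the Lefschetz-group case `S(A^{r+1}) = S(A)` is in
  `Summits/HodgeConjecture/HodgeConjecture/Theorems/Ring2HypothesesDescentAbsoluteExteriorLefschetzH1`, not importable here).

## References

* [MoonenZarhin1999LowDim] B. Moonen, Yu. Zarhin, Hodge classes on abelian varieties of low dimension, Math. Ann. 315 (1999), §1.
* [Milne1999LefschetzClasses] J. S. Milne, Lefschetz classes on abelian varieties, Duke Math. J. 96 (1999), §1 p. 643, §4 Def. 4.3.
* [Deligne1982HodgeCycles] P. Deligne, Hodge cycles on abelian varieties, LNM 900 (1982), I §3 (Prop. 3.4, before Thm. 3.8).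
* [vanGeemen1994HodgeAV] B. van Geemen, LNM 1594 (1994), 6.4–6.5.
* [LangeBirkenhake1992] Ch. Birkenhake, H. Lange, Complex Abelian Varieties (1992), §1.1, Lemma 1.1.17, Thm. 4.2.1.
* [HatcherAT2002] A. Hatcher, Algebraic Topology (2002), §3.2 Thm. 3.16.
-/

noncomputable section

open CategoryTheory MonoidalCategory CartesianMonoidalCategory
open Literature.AlgebraicTopology.SingularHomology
open Literature.AlgebraicGeometry.HodgeTheory
open Literature.AlgebraicGeometry.Motives
open Literature.AlgebraicGeometry.VanGeemen1994 (hodgeGroupOne mem_hodgeGroupOne_iff)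

namespace Literature.AlgebraicGeometry.Milne1999

/-! ### §1 `⋀•` is functorial along homomorphisms intertwining the `H¹`-actions -/

section Functorial

/-- **`⋀ᵏU_P ∘ f^* = f^* ∘ ⋀ᵏU_Q` on `Hᵏ`, given `U_P ∘ f^* = f^* ∘ U_Q` on `H¹`**, for a homomorphism `f : P → Q` of complex abelian
varieties: `f^*` and the exterior pull-backs are multiplicative on the monomials `v₁ ∪ ⋯ ∪ v_k`, which span `Hᵏ = ⋀ᵏH¹`
(`complexBetti_map_cupPowOne`, `exteriorPullback_cupPowOne`). [cite: HatcherAT2002, §3.2 Example 3.16] [cite: LangeBirkenhake1992, Lemma 1.1.17] -/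
theorem exteriorPullback_map_of_intertwine {P Q : AbelianVariety ℂ} (f : P ⟶ Q)
    (UP : complexBetti P.X 1 →ₗ[ℂ] complexBetti P.X 1) (UQ : complexBetti Q.X 1 →ₗ[ℂ] complexBetti Q.X 1)
    (h : ∀ y : complexBetti Q.X 1, UP (complexBetti.map f.hom.hom.hom 1 y) = complexBetti.map f.hom.hom.hom 1 (UQ y))
    (k : ℕ) (z : complexBetti Q.X k) :
    exteriorPullback (AbelianVariety.hasExteriorCohomologyH1_complexPoints P) UP k (complexBetti.map f.hom.hom.hom k z) =
      complexBetti.map f.hom.hom.hom k (exteriorPullback (AbelianVariety.hasExteriorCohomologyH1_complexPoints Q) UQ k z) := by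
  have hP := AbelianVariety.hasExteriorCohomologyH1_complexPoints P
  have hQ := AbelianVariety.hasExteriorCohomologyH1_complexPoints Q
  have key : (exteriorPullback hP UP k) ∘ₗ (complexBetti.map f.hom.hom.hom k).hom =
      (complexBetti.map f.hom.hom.hom k).hom ∘ₗ exteriorPullback hQ UQ k := by
    refine exteriorPullback_ext hQ fun v ↦ ?_
    change exteriorPullback hP UP k (complexBetti.map f.hom.hom.hom k (cupPowOne ℂ (ComplexPoints Q.X) k v)) =
      complexBetti.map f.hom.hom.hom k (exteriorPullback hQ UQ k (cupPowOne ℂ (ComplexPoints Q.X) k v))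
    rw [complexBetti_map_cupPowOne, exteriorPullback_cupPowOne, exteriorPullback_cupPowOne, complexBetti_map_cupPowOne]
    congr 1
    funext j
    exact h (v j)
  exact LinearMap.congr_fun key z

/-- `(ι ≫ π)^* = 𝟙` on every `Hᵏ` for a section–retraction pair: `ι^* (π^* y) = y`. [cite: HatcherAT2002, §3.2 Thm. 3.16] -/
theorem map_map_of_comp_eq_id {X P : AbelianVariety ℂ} {ι : X ⟶ P} {π : P ⟶ X} (h : ι ≫ π = 𝟙 X) (k : ℕ)
    (y : complexBetti X.X k) : complexBetti.map ι.hom.hom.hom k (complexBetti.map π.hom.hom.hom k y) = y := by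
  rw [← complexBetti_map_comp_apply, h]
  change complexBetti.map (𝟙 X.X) k y = y
  rw [complexBetti.map_id]
  rfl

end Functorial

/-! ### §2 Homomorphisms between powers intertwine the diagonal actions of `C(A) ⊗ ℂ` -/

section Intertwine

/-- Block step, target a product: if `U_P ∘ (f ≫ pr_X)^* = (f ≫ pr_X)^* ∘ U_X` and `U_P ∘ (f ≫ pr_C)^* = (f ≫ pr_C)^* ∘ U_C` on `H¹`,
then `U_P ∘ f^* = f^* ∘ (U_X ⊕ U_C)` for `f : P → X × C` (`H¹(X × C) = pr_X^* H¹(X) ⊕ pr_C^* H¹(C)`). [cite: Milne1999LefschetzClasses, §1 p. 643]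
[cite: HatcherAT2002, §3.2 Thm. 3.16] -/
theorem apply_map_eq_map_prodBlockDiagEquiv {P X C : AbelianVariety ℂ} (UP : complexBetti P.X 1 ≃ₗ[ℂ] complexBetti P.X 1)
    (UX : complexBetti X.X 1 ≃ₗ[ℂ] complexBetti X.X 1) (UC : complexBetti C.X 1 ≃ₗ[ℂ] complexBetti C.X 1) (f : P ⟶ X.prod C)
    (hX : ∀ q : complexBetti X.X 1, UP (complexBetti.map (f ≫ AbelianVariety.fst X C).hom.hom.hom 1 q) =
      complexBetti.map (f ≫ AbelianVariety.fst X C).hom.hom.hom 1 (UX q))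
    (hC : ∀ z : complexBetti C.X 1, UP (complexBetti.map (f ≫ AbelianVariety.snd X C).hom.hom.hom 1 z) =
      complexBetti.map (f ≫ AbelianVariety.snd X C).hom.hom.hom 1 (UC z))
    (y : complexBetti (X.prod C).X 1) :
    UP (complexBetti.map f.hom.hom.hom 1 y) = complexBetti.map f.hom.hom.hom 1 (prodBlockDiagEquiv UX UC y) := by
  rw [eq_map_fst_add_map_snd_one y]
  set q := complexBetti.map (AbelianVariety.prodLift (𝟙 X) (0 : X ⟶ C)).hom.hom.hom 1 y
  set z := complexBetti.map (AbelianVariety.prodLift (0 : C ⟶ X) (𝟙 C)).hom.hom.hom 1 y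
  have hX' := hX q
  have hC' := hC z
  rw [complexBetti_map_comp_apply, complexBetti_map_comp_apply] at hX' hC'
  rw [map_add, map_add, hX', hC', map_add, prodBlockDiagEquiv_apply_map_fst, prodBlockDiagEquiv_apply_map_snd, map_add]

/-- Block step, source a product: if `U_X ∘ (ι_X ≫ f)^* = (ι_X ≫ f)^* ∘ U_Q` and `U_C ∘ (ι_C ≫ f)^* = (ι_C ≫ f)^* ∘ U_Q` on `H¹`,
then `(U_X ⊕ U_C) ∘ f^* = f^* ∘ U_Q` for `f : X × C → Q`. [cite: Milne1999LefschetzClasses, §1 p. 643] [cite: HatcherAT2002, §3.2 Thm. 3.16] -/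
theorem prodBlockDiagEquiv_map_eq_map {X C Q : AbelianVariety ℂ} (UX : complexBetti X.X 1 ≃ₗ[ℂ] complexBetti X.X 1)
    (UC : complexBetti C.X 1 ≃ₗ[ℂ] complexBetti C.X 1) (UQ : complexBetti Q.X 1 ≃ₗ[ℂ] complexBetti Q.X 1) (f : X.prod C ⟶ Q)
    (hX : ∀ y : complexBetti Q.X 1, UX (complexBetti.map (AbelianVariety.prodLift (𝟙 X) (0 : X ⟶ C) ≫ f).hom.hom.hom 1 y) =
      complexBetti.map (AbelianVariety.prodLift (𝟙 X) (0 : X ⟶ C) ≫ f).hom.hom.hom 1 (UQ y))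
    (hC : ∀ y : complexBetti Q.X 1, UC (complexBetti.map (AbelianVariety.prodLift (0 : C ⟶ X) (𝟙 C) ≫ f).hom.hom.hom 1 y) =
      complexBetti.map (AbelianVariety.prodLift (0 : C ⟶ X) (𝟙 C) ≫ f).hom.hom.hom 1 (UQ y))
    (y : complexBetti Q.X 1) :
    prodBlockDiagEquiv UX UC (complexBetti.map f.hom.hom.hom 1 y) = complexBetti.map f.hom.hom.hom 1 (UQ y) := by
  rw [map_one_eq_add_of_prod f y, map_one_eq_add_of_prod f (UQ y), map_add, prodBlockDiagEquiv_apply_map_fst,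
    prodBlockDiagEquiv_apply_map_snd, hX, hC]

variable {A : AbelianVariety ℂ} {u : complexBetti A.X 1 ≃ₗ[ℂ] complexBetti A.X 1}

/-- **`u^{⊕(m+1)} ∘ f^* = f^* ∘ u^{⊕(n+1)}` for every homomorphism `f : A^{m+1} → A^{n+1}`** and `u ∈ C(A) ⊗ ℂ` (Milne §1 p. 643:
"the diagonal action of `C(A)` on `rV(A)` identifies `C(A)` with `C(A^r)`", for rectangular blocks: the entries of `f` are
endomorphisms of `A`). Induction on `n` through `H¹(A^{n+2}) = pr^* H¹(A^{n+1}) ⊕ pr_A^* H¹(A)`. [cite: Milne1999LefschetzClasses, §1 p. 643] -/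
theorem diagPow_map_powSucc (hu : u ∈ centralizerGroup A) (m : ℕ) :
    ∀ (n : ℕ) (f : A.powSucc m ⟶ A.powSucc n) (y : complexBetti (A.powSucc n).X 1),
      diagPow A u m (complexBetti.map f.hom.hom.hom 1 y) = complexBetti.map f.hom.hom.hom 1 (diagPow A u n y)
  | 0, f, y => diagPow_intertwine_right hu f y
  | n + 1, f, y => apply_map_eq_map_prodBlockDiagEquiv (diagPow A u m) (diagPow A u n) u f
      (fun q ↦ diagPow_map_powSucc hu m n _ q) (fun z ↦ diagPow_intertwine_right hu _ z) y

/-- **`u^{⊕(m+1)} ∘ f^* = f^* ∘ (u^{⊕(r+1)})^{⊕(a+1)}` for every homomorphism `f : A^{m+1} → (A^{r+1})^{a+1}`** (`u ∈ C(A) ⊗ ℂ`).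
[cite: Milne1999LefschetzClasses, §1 p. 643] -/
theorem diagPow_map_powSucc_powSucc (hu : u ∈ centralizerGroup A) (r m : ℕ) :
    ∀ (a : ℕ) (f : A.powSucc m ⟶ (A.powSucc r).powSucc a) (y : complexBetti ((A.powSucc r).powSucc a).X 1),
      diagPow A u m (complexBetti.map f.hom.hom.hom 1 y) =
        complexBetti.map f.hom.hom.hom 1 (diagPow (A.powSucc r) (diagPow A u r) a y)
  | 0, f, y => diagPow_map_powSucc hu m r f y
  | a + 1, f, y => apply_map_eq_map_prodBlockDiagEquiv (diagPow A u m) (diagPow (A.powSucc r) (diagPow A u r) a)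
      (diagPow A u r) f (fun q ↦ diagPow_map_powSucc_powSucc hu r m a _ q) (fun z ↦ diagPow_map_powSucc hu m r _ z) y

/-- `(u^{⊕(r+1)})^{⊕(a+1)} ∘ f^* = f^* ∘ u` for every homomorphism `f : (A^{r+1})^{a+1} → A` (`u ∈ C(A) ⊗ ℂ`); induction on `a` through
`H¹` of the source. [cite: Milne1999LefschetzClasses, §1 p. 643] -/
theorem diagPow_powSucc_map (hu : u ∈ centralizerGroup A) (r : ℕ) :
    ∀ (a : ℕ) (f : (A.powSucc r).powSucc a ⟶ A) (y : complexBetti A.X 1),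
      diagPow (A.powSucc r) (diagPow A u r) a (complexBetti.map f.hom.hom.hom 1 y) = complexBetti.map f.hom.hom.hom 1 (u y)
  | 0, f, y => diagPow_intertwine_right hu f y
  | a + 1, f, y => prodBlockDiagEquiv_map_eq_map (diagPow (A.powSucc r) (diagPow A u r) a) (diagPow A u r) u f
      (fun z ↦ diagPow_powSucc_map hu r a _ z) (fun z ↦ diagPow_intertwine_right hu _ z) y

/-- **`(u^{⊕(r+1)})^{⊕(a+1)} ∘ f^* = f^* ∘ u^{⊕(m+1)}` for every homomorphism `f : (A^{r+1})^{a+1} → A^{m+1}`** (`u ∈ C(A) ⊗ ℂ`).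
[cite: Milne1999LefschetzClasses, §1 p. 643] -/
theorem diagPow_powSucc_map_powSucc (hu : u ∈ centralizerGroup A) (r a : ℕ) :
    ∀ (m : ℕ) (f : (A.powSucc r).powSucc a ⟶ A.powSucc m) (y : complexBetti (A.powSucc m).X 1),
      diagPow (A.powSucc r) (diagPow A u r) a (complexBetti.map f.hom.hom.hom 1 y) =
        complexBetti.map f.hom.hom.hom 1 (diagPow A u m y)
  | 0, f, y => diagPow_powSucc_map hu r a f y
  | m + 1, f, y => apply_map_eq_map_prodBlockDiagEquiv (diagPow (A.powSucc r) (diagPow A u r) a) (diagPow A u m) u f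
      (fun q ↦ diagPow_powSucc_map_powSucc hu r a m _ q) (fun z ↦ diagPow_powSucc_map hu r a _ z) y

end Intertwine

/-! ### §3 Retractions: `A^{a+1}` inside `(A^{r+1})^{a+1}`, and `(A^{r+1})^{a+1}` inside a power of `A` -/

section Retractions

/-- `prodLift f g ≫ pr₁ ≫ h = f ≫ h` (reassociated `prodLift_fst`). [folklore] -/
private theorem prodLift_fst_comp {T X C Z : AbelianVariety ℂ} (f : T ⟶ X) (g : T ⟶ C) (h : X ⟶ Z) :
    AbelianVariety.prodLift f g ≫ AbelianVariety.fst X C ≫ h = f ≫ h := by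
  rw [← Category.assoc, AbelianVariety.prodLift_fst]

/-- `prodLift f g ≫ pr₂ ≫ h = g ≫ h` (reassociated `prodLift_snd`). [folklore] -/
private theorem prodLift_snd_comp {T X C Z : AbelianVariety ℂ} (f : T ⟶ X) (g : T ⟶ C) (h : C ⟶ Z) :
    AbelianVariety.prodLift f g ≫ AbelianVariety.snd X C ≫ h = g ≫ h := by
  rw [← Category.assoc, AbelianVariety.prodLift_snd]

/-- A product of retractions is a retraction. [folklore] -/
private theorem prodLift_retraction {X X' C C' : AbelianVariety ℂ} {ι : X ⟶ X'} {π : X' ⟶ X} (h : ι ≫ π = 𝟙 X) {ι₀ : C ⟶ C'}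
    {π₀ : C' ⟶ C} (h₀ : ι₀ ≫ π₀ = 𝟙 C) :
    AbelianVariety.prodLift (AbelianVariety.fst X C ≫ ι) (AbelianVariety.snd X C ≫ ι₀) ≫
        AbelianVariety.prodLift (AbelianVariety.fst X' C' ≫ π) (AbelianVariety.snd X' C' ≫ π₀) = 𝟙 (X.prod C) := by
  refine AbelianVariety.prod_hom_ext ?_ ?_
  · rw [Category.assoc, AbelianVariety.prodLift_fst, ← Category.assoc, AbelianVariety.prodLift_fst, Category.assoc, h,
      Category.id_comp, Category.comp_id]
  · rw [Category.assoc, AbelianVariety.prodLift_snd, ← Category.assoc, AbelianVariety.prodLift_snd, Category.assoc, h₀,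
      Category.id_comp, Category.comp_id]

/-- Reassociation `X × (Y × C) → (X × Y) × C` is a retraction (indeed an isomorphism). [folklore] -/
private theorem prodLift_assoc_retraction (X Y C : AbelianVariety ℂ) :
    AbelianVariety.prodLift (AbelianVariety.prodLift (AbelianVariety.fst X (Y.prod C))
        (AbelianVariety.snd X (Y.prod C) ≫ AbelianVariety.fst Y C)) (AbelianVariety.snd X (Y.prod C) ≫ AbelianVariety.snd Y C) ≫
      AbelianVariety.prodLift (AbelianVariety.fst (X.prod Y) C ≫ AbelianVariety.fst X Y)
        (AbelianVariety.prodLift (AbelianVariety.fst (X.prod Y) C ≫ AbelianVariety.snd X Y) (AbelianVariety.snd (X.prod Y) C)) =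
      𝟙 (X.prod (Y.prod C)) := by
  refine AbelianVariety.prod_hom_ext ?_ (AbelianVariety.prod_hom_ext ?_ ?_) <;>
    simp only [Category.assoc, Category.id_comp, prodLift_fst_comp, AbelianVariety.prodLift_fst, AbelianVariety.prodLift_snd]

/-- Retractions compose. [folklore] -/
private theorem comp_retraction {X Y Z : AbelianVariety ℂ} {ι : X ⟶ Y} {π : Y ⟶ X} (h : ι ≫ π = 𝟙 X) {ι' : Y ⟶ Z} {π' : Z ⟶ Y}
    (h' : ι' ≫ π' = 𝟙 Y) : (ι ≫ ι') ≫ (π' ≫ π) = 𝟙 X := by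
  rw [Category.assoc, ← Category.assoc ι', h', Category.id_comp, h]

variable (A : AbelianVariety ℂ)

/-- **`A^{a+1}` is a retract of `(A^{r+1})^{a+1}`** (blockwise a factor inclusion / projection, `exists_section_powSucc`).
[cite: LangeBirkenhake1992, Thm. 4.2.1] -/
theorem exists_retraction_powSucc_powSucc (r : ℕ) :
    ∀ a : ℕ, ∃ (ι : A.powSucc a ⟶ (A.powSucc r).powSucc a) (π : (A.powSucc r).powSucc a ⟶ A.powSucc a), ι ≫ π = 𝟙 _
  | 0 => exists_section_powSucc A r
  | a + 1 => by
    obtain ⟨ι, π, h⟩ := exists_retraction_powSucc_powSucc r a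
    obtain ⟨ι₀, π₀, h₀⟩ := exists_section_powSucc A r
    exact ⟨_, _, prodLift_retraction h h₀⟩

/-- **`A^{N+1} × A^{r+1}` is a retract of `A^{N+r+2}`** (in fact isomorphic: reassociate), by induction on `r`.
[cite: LangeBirkenhake1992, Thm. 4.2.1] -/
theorem exists_retraction_powSucc_prod_powSucc (N : ℕ) :
    ∀ r : ℕ, ∃ (ι : (A.powSucc N).prod (A.powSucc r) ⟶ A.powSucc (N + r + 1))
      (π : A.powSucc (N + r + 1) ⟶ (A.powSucc N).prod (A.powSucc r)), ι ≫ π = 𝟙 _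
  | 0 => ⟨𝟙 _, 𝟙 _, Category.comp_id _⟩
  | r + 1 => by
    obtain ⟨ι, π, h⟩ := exists_retraction_powSucc_prod_powSucc N r
    -- `A^{N+1} × (A^{r+1} × A) → (A^{N+1} × A^{r+1}) × A → A^{N+r+2} × A = A^{N+r+3}`
    exact ⟨_, _, comp_retraction (prodLift_assoc_retraction (A.powSucc N) (A.powSucc r) A)
      (prodLift_retraction h (Category.comp_id (𝟙 A)))⟩

/-- **`(A^{r+1})^{a+1}` is a retract of a power `A^{N+1}`** (`N + 1 = (r+1)(a+1)`; only the existence of a retraction is recorded).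
[cite: LangeBirkenhake1992, Thm. 4.2.1] -/
theorem exists_retraction_powSucc_powSucc_powSucc (r : ℕ) :
    ∀ a : ℕ, ∃ (N : ℕ) (ι : (A.powSucc r).powSucc a ⟶ A.powSucc N) (π : A.powSucc N ⟶ (A.powSucc r).powSucc a), ι ≫ π = 𝟙 _
  | 0 => ⟨r, 𝟙 _, 𝟙 _, Category.comp_id _⟩
  | a + 1 => by
    obtain ⟨N, ι, π, h⟩ := exists_retraction_powSucc_powSucc_powSucc r a
    obtain ⟨ι', π', h'⟩ := exists_retraction_powSucc_prod_powSucc A N r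
    -- `(A^{r+1})^{a+1} × A^{r+1} → A^{N+1} × A^{r+1} → A^{N+r+2}`
    exact ⟨N + r + 1, _, _, comp_retraction (prodLift_retraction h (Category.comp_id (𝟙 (A.powSucc r)))) h'⟩

end Retractions

/-! ### §4 `Hg` acts through `H¹` as a family; its Künneth family; transport to the abelian variety `A^{a+1}` -/

section HodgeGroup

variable {A : AbelianVariety ℂ} {g : ∀ k : ℕ, complexBetti A.X k ≃ₗ[ℂ] complexBetti A.X k}

/-- **`g = (⋀ᵏ(g₁))_k` for `g ∈ Hg(A)(ℂ)`** (the tree's `hodgeGroup_apply_cupPowOne`, van Geemen 6.5, read as an equality of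
families). [cite: vanGeemen1994HodgeAV, 6.4–6.5] [cite: Deligne1982HodgeCycles, I §3] -/
theorem hodgeGroup_eq_exteriorPullbackEquiv (hg : g ∈ hodgeGroup A.dim A.X) :
    g = fun k ↦ exteriorPullbackEquiv (AbelianVariety.hasExteriorCohomologyH1_complexPoints A) (g 1) k := by
  funext k
  refine LinearEquiv.toLinearMap_injective ?_
  rw [coe_exteriorPullbackEquiv]
  refine exteriorPullback_ext (AbelianVariety.hasExteriorCohomologyH1_complexPoints A) fun v ↦ ?_
  rw [LinearEquiv.coe_coe, hodgeGroup_apply_cupPowOne hg, exteriorPullback_cupPowOne]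
  rfl

/-- **The Künneth family of `g ∈ Hg(A)(ℂ)` is `⋀•(g₁^{⊕(a+1)})`** (`exteriorKunnethFamily A (g 1)`): uniqueness of Künneth families
(`IsKunnethFamily.ext_of_apply_zero`). [cite: Milne1999LefschetzClasses, Def. 4.3 and §4 p. 658] [cite: HatcherAT2002, §3.2 Thm. 3.16] -/
theorem kunnethFamily_eq_exteriorKunnethFamily_of_mem_hodgeGroup (hg : g ∈ hodgeGroup A.dim A.X)
    {G : ∀ a k : ℕ, complexBetti (cartesianPow A.X (a + 1)) k ≃ₗ[ℂ] complexBetti (cartesianPow A.X (a + 1)) k}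
    (hG : IsKunnethFamily A.X G) (h0 : G 0 = g) : G = exteriorKunnethFamily A (g 1) :=
  IsKunnethFamily.ext_of_apply_zero AbelianVariety.isSmoothProjective_holds hG (isKunnethFamily_exteriorKunnethFamily A (g 1))
    (h0.trans ((hodgeGroup_eq_exteriorPullbackEquiv hg).trans (exteriorKunnethFamily_zero A (g 1)).symm))

/-- Transport, cartesian power → abelian variety: if `castAut e G` fixes the rational `(p,p)`-classes of `Y'` (dimension `N'`) then
`G` fixes those of `Y` (dimension `N`), along `Y = Y'`, `N = N'` (private plumbing, by `subst`). [folklore] -/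
private theorem apply_eq_self_of_castAut {Y Y' : Motives.SchemeOver ℂ} (e : Y = Y') {N N' : ℕ} (hN : N = N')
    (G : ∀ k : ℕ, complexBetti Y k ≃ₗ[ℂ] complexBetti Y k)
    (h : ∀ (p : ℕ) (x : complexBetti Y' (2 * p)), IsRationalClass x → IsOfHodgeType N' Y' (2 * p) p p x →
      castAut e G (2 * p) x = x)
    (p : ℕ) (c : complexBetti Y (2 * p)) (hc : IsRationalClass c) (hc' : IsOfHodgeType N Y (2 * p) p p c) : G (2 * p) c = c := by
  subst e hN
  exact h p c hc hc'

/-- Transport, abelian variety → cartesian power (private plumbing, by `subst`). [folklore] -/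
private theorem castAut_apply_eq_self_of {Y Y' : Motives.SchemeOver ℂ} (e : Y = Y') {N N' : ℕ} (hN : N = N')
    (G : ∀ k : ℕ, complexBetti Y k ≃ₗ[ℂ] complexBetti Y k)
    (h : ∀ (p : ℕ) (c : complexBetti Y (2 * p)), IsRationalClass c → IsOfHodgeType N Y (2 * p) p p c → G (2 * p) c = c)
    (p : ℕ) (x : complexBetti Y' (2 * p)) (hx : IsRationalClass x) (hx' : IsOfHodgeType N' Y' (2 * p) p p x) :
    castAut e G (2 * p) x = x := by
  subst e hN
  exact h p x hx hx'

/-- **For `g ∈ Hg(A)(ℂ)`, `⋀•(g₁^{⊕(a+1)})` fixes every rational `(p,p)`-class of the abelian variety `A^{a+1}`** (its Künneth family,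
read on `(A^{a+1}).X = A.X^{×(a+1)}`). [cite: Deligne1982HodgeCycles, I §3 (before Thm. 3.8)] [cite: Milne1999LefschetzClasses, Def. 4.3] -/
theorem diagPowExterior_apply_eq_self_of_mem_hodgeGroup (hg : g ∈ hodgeGroup A.dim A.X) (a p : ℕ)
    {c : complexBetti (A.powSucc a).X (2 * p)} (hc : IsRationalClass c) (hc' : IsOfHodgeType (A.powSucc a).dim (A.powSucc a).X (2 * p) p p c) :
    diagPowExterior A (g 1) a (2 * p) c = c := by
  obtain ⟨G, hG, h0, hfix⟩ := hg
  have hGeq : G = exteriorKunnethFamily A (g 1) :=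
    kunnethFamily_eq_exteriorKunnethFamily_of_mem_hodgeGroup ⟨G, hG, h0, hfix⟩ hG h0
  refine apply_eq_self_of_castAut (A.powSucc_X_eq_cartesianPow a) (A.dim_powSucc_eq_cartesianPowDim a) (diagPowExterior A (g 1) a)
    (fun q x hx hx' ↦ ?_) p c hc hc'
  have e := hfix a q x ⟨hx, hx'⟩
  rwa [hGeq] at e

/-- **Conversely**: if `⋀•(u^{⊕(a+1)})` fixes every rational `(p,p)`-class of every `A^{a+1}`, then `(⋀ᵏu)_k ∈ Hg(A)(ℂ)`.
[cite: Deligne1982HodgeCycles, I §3 (before Thm. 3.8)] -/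
theorem exteriorPullbackEquiv_mem_hodgeGroup_of_forall {u : complexBetti A.X 1 ≃ₗ[ℂ] complexBetti A.X 1}
    (h : ∀ (a p : ℕ) (c : complexBetti (A.powSucc a).X (2 * p)), IsRationalClass c →
      IsOfHodgeType (A.powSucc a).dim (A.powSucc a).X (2 * p) p p c → diagPowExterior A u a (2 * p) c = c) :
    (fun k ↦ exteriorPullbackEquiv (AbelianVariety.hasExteriorCohomologyH1_complexPoints A) u k) ∈ hodgeGroup A.dim A.X :=
  ⟨exteriorKunnethFamily A u, isKunnethFamily_exteriorKunnethFamily A u, exteriorKunnethFamily_zero A u,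
    fun a p x hx ↦ castAut_apply_eq_self_of (A.powSucc_X_eq_cartesianPow a) (A.dim_powSucc_eq_cartesianPowDim a)
      (diagPowExterior A u a) (h a) p x hx.1 hx.2⟩

end HodgeGroup

/-! ### §5 Moonen–Zarhin: `Hg(A^{r+1}) = Hg(A)` acting diagonally -/

section MoonenZarhin

variable (A : AbelianVariety ℂ) (r : ℕ)

/-- **`⊇`: the diagonal of the Hodge group lies in the Hodge group of the power.** For `u ∈ Hg(A)(ℂ)|_{H¹}` the family
`⋀•(u^{⊕(r+1)})` on `H•(A^{r+1}(ℂ); ℂ)` lies in `Hg(A^{r+1})(ℂ)`: its Künneth family `⋀•((u^{⊕(r+1)})^{⊕(a+1)})` fixes every Hodge class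
`c` of `(A^{r+1})^{a+1}` — pull `c` back along a retraction `π' : A^{N+1} → (A^{r+1})^{a+1}` (§3), where `⋀•(u^{⊕(N+1)})` fixes it
(`u ∈ Hg(A)|_{H¹}`), use that `π'^*` intertwines (§1–§2) and is injective. [cite: MoonenZarhin1999LowDim, §1]
[cite: Milne1999LefschetzClasses, §1 p. 643] -/
theorem diagPowExterior_mem_hodgeGroup_powSucc {u : complexBetti A.X 1 ≃ₗ[ℂ] complexBetti A.X 1}
    (hu : u ∈ hodgeGroupOne A.dim A.X) : diagPowExterior A u r ∈ hodgeGroup (A.powSucc r).dim (A.powSucc r).X := by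
  obtain ⟨g, hg, rfl⟩ := mem_hodgeGroupOne_iff.1 hu
  have hC : g 1 ∈ centralizerGroup A := hodgeGroupOne_le_centralizerGroup hu
  -- `⋀•(u'^{⊕(a+1)})` fixes the Hodge classes of every `(A^{r+1})^{a+1}`
  have key : ∀ (a p : ℕ) (c : complexBetti ((A.powSucc r).powSucc a).X (2 * p)), IsRationalClass c →
      IsOfHodgeType ((A.powSucc r).powSucc a).dim ((A.powSucc r).powSucc a).X (2 * p) p p c →
        diagPowExterior (A.powSucc r) (diagPow A (g 1) r) a (2 * p) c = c := by
    intro a p c hc hc'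
    obtain ⟨N, ι', π', hιπ⟩ := exists_retraction_powSucc_powSucc_powSucc A r a
    have hB : IsSmoothProjective ((A.powSucc r).powSucc a).dim ((A.powSucc r).powSucc a).X :=
      AbelianVariety.isSmoothProjective_holds
    have hN : IsSmoothProjective (A.powSucc N).dim (A.powSucc N).X := AbelianVariety.isSmoothProjective_holds
    -- `π'^* c` is a Hodge class of `A^{N+1}`, fixed by `⋀•(u^{⊕(N+1)})`
    have hfix := diagPowExterior_apply_eq_self_of_mem_hodgeGroup hg N p (c := complexBetti.map π'.hom.hom.hom (2 * p) c)
      (hc.pullback _) (hc'.map_of_isSmoothProjective hN hB π'.hom.hom.hom)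
    rw [diagPowExterior, exteriorPullbackEquiv_apply,
      exteriorPullback_map_of_intertwine π' (diagPow A (g 1) N).toLinearMap (diagPow (A.powSucc r) (diagPow A (g 1) r) a).toLinearMap
        (fun y ↦ diagPow_map_powSucc_powSucc hC r N a π' y)] at hfix
    have e := congrArg (complexBetti.map ι'.hom.hom.hom (2 * p)) hfix
    rwa [map_map_of_comp_eq_id hιπ, map_map_of_comp_eq_id hιπ, ← exteriorPullbackEquiv_apply] at e
  exact exteriorPullbackEquiv_mem_hodgeGroup_of_forall key

/-- **`⊆` (the half `HodgeTheory/HodgeGroupPowersCentre` could not prove): every element of `Hg(A^{r+1})(ℂ)` is `⋀•(u^{⊕(r+1)})` for a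
`u ∈ Hg(A)(ℂ)|_{H¹}`.** `g'` acts through `H¹(A^{r+1})` (`hodgeGroup_eq_exteriorPullbackEquiv`), `g'₁ ∈ C(A^{r+1}) = C(A)^{diag}`
(`hodgeGroupOne_le_centralizerGroup`, `exists_eq_diagPow_of_mem_centralizerGroup`), so `g' = ⋀•(u^{⊕(r+1)})` with `u ∈ C(A) ⊗ ℂ`; and
`(⋀ᵏu)_k ∈ Hg(A)`: its Künneth family fixes every Hodge class `c` of `A^{a+1}` — pull `c` back along a retraction
`π : (A^{r+1})^{a+1} → A^{a+1}` (§3), where the Künneth family of `g'` fixes it, and come back (§1–§2).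
[cite: MoonenZarhin1999LowDim, §1] [cite: Milne1999LefschetzClasses, §1 p. 643] -/
theorem exists_mem_hodgeGroupOne_of_mem_hodgeGroup_powSucc
    {g' : ∀ k : ℕ, complexBetti (A.powSucc r).X k ≃ₗ[ℂ] complexBetti (A.powSucc r).X k}
    (hg' : g' ∈ hodgeGroup (A.powSucc r).dim (A.powSucc r).X) :
    ∃ u ∈ hodgeGroupOne A.dim A.X, g' = diagPowExterior A u r := by
  -- `g'₁ ∈ C(A^{r+1}) = C(A)` diagonally
  have h1 : g' 1 ∈ centralizerGroup (A.powSucc r) :=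
    hodgeGroupOne_le_centralizerGroup (mem_hodgeGroupOne_iff.2 ⟨g', hg', rfl⟩)
  obtain ⟨u, hu, huU⟩ := exists_eq_diagPow_of_mem_centralizerGroup r (g' 1) h1
  have hg'eq : g' = diagPowExterior A u r := by
    rw [hodgeGroup_eq_exteriorPullbackEquiv hg', ← huU]
    rfl
  refine ⟨u, ?_, hg'eq⟩
  -- `(⋀ᵏu)_k ∈ Hg(A)`: `⋀•(u^{⊕(a+1)})` fixes the Hodge classes of every `A^{a+1}`
  have key : ∀ (a p : ℕ) (c : complexBetti (A.powSucc a).X (2 * p)), IsRationalClass c →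
      IsOfHodgeType (A.powSucc a).dim (A.powSucc a).X (2 * p) p p c → diagPowExterior A u a (2 * p) c = c := by
    intro a p c hc hc'
    obtain ⟨ι, π, hιπ⟩ := exists_retraction_powSucc_powSucc A r a
    have hP : IsSmoothProjective (A.powSucc a).dim (A.powSucc a).X := AbelianVariety.isSmoothProjective_holds
    have hB : IsSmoothProjective ((A.powSucc r).powSucc a).dim ((A.powSucc r).powSucc a).X :=
      AbelianVariety.isSmoothProjective_holds
    -- `π^* c` is a Hodge class of `(A^{r+1})^{a+1}`, fixed by the Künneth family `⋀•((u^{⊕(r+1)})^{⊕(a+1)})` of `g'`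
    have hfix := diagPowExterior_apply_eq_self_of_mem_hodgeGroup hg' a p (c := complexBetti.map π.hom.hom.hom (2 * p) c)
      (hc.pullback _) (hc'.map_of_isSmoothProjective hB hP π.hom.hom.hom)
    rw [← huU, diagPowExterior, exteriorPullbackEquiv_apply,
      exteriorPullback_map_of_intertwine π (diagPow (A.powSucc r) (diagPow A u r) a).toLinearMap (diagPow A u a).toLinearMap
        (fun y ↦ diagPow_powSucc_map_powSucc hu r a a π y)] at hfix
    have e := congrArg (complexBetti.map ι.hom.hom.hom (2 * p)) hfix
    rwa [map_map_of_comp_eq_id hιπ, map_map_of_comp_eq_id hιπ, ← exteriorPullbackEquiv_apply] at e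
  have hmem := exteriorPullbackEquiv_mem_hodgeGroup_of_forall key
  exact mem_hodgeGroupOne_iff.2 ⟨_, hmem, exteriorPullbackEquiv_one_eq _ u⟩

/-- **MOONEN–ZARHIN, TANNAKA-FREE: `Hg(A^{r+1}) = Hg(A)` acting diagonally.** A family `g'` of automorphisms of the
`Hᵏ(A^{r+1}(ℂ); ℂ)` lies in the Hodge group of the power `hodgeGroup (dim A^{r+1}) (A^{r+1}).X` (Künneth families on the powers of
`A^{r+1}` fixing their rational `(p,p)`-classes) iff `g' = ⋀•(u^{⊕(r+1)})` for some — unique, `diagPow_injective` — `u` in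
`Hg(A)(ℂ)|_{H¹} = hodgeGroupOne (dim A) A.X`: "For `n ≥ 1` we can identify `Hg(Xⁿ)` with `Hg(X)`, acting diagonally on
`V_{Xⁿ} = (V_X)ⁿ`". [cite: MoonenZarhin1999LowDim, §1] [cite: Milne1999LefschetzClasses, §1 p. 643] -/
theorem mem_hodgeGroup_powSucc_iff (g' : ∀ k : ℕ, complexBetti (A.powSucc r).X k ≃ₗ[ℂ] complexBetti (A.powSucc r).X k) :
    g' ∈ hodgeGroup (A.powSucc r).dim (A.powSucc r).X ↔ ∃ u ∈ hodgeGroupOne A.dim A.X, g' = diagPowExterior A u r :=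
  ⟨exists_mem_hodgeGroupOne_of_mem_hodgeGroup_powSucc A r, fun ⟨_, hu, e⟩ ↦ e ▸ diagPowExterior_mem_hodgeGroup_powSucc A r hu⟩

/-- **On `H¹`: `Hg(A^{r+1})(ℂ)|_{H¹} = {u^{⊕(r+1)} | u ∈ Hg(A)(ℂ)|_{H¹}}`** — the diagonal embedding `u ↦ u^{⊕(r+1)}` (the lane's
`diagPow`, injective) carries `hodgeGroupOne (dim A) A.X` ONTO `hodgeGroupOne (dim A^{r+1}) (A^{r+1}).X`.
[cite: MoonenZarhin1999LowDim, §1] [cite: Milne1999LefschetzClasses, §1 p. 643] -/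
theorem mem_hodgeGroupOne_powSucc_iff (U : complexBetti (A.powSucc r).X 1 ≃ₗ[ℂ] complexBetti (A.powSucc r).X 1) :
    U ∈ hodgeGroupOne (A.powSucc r).dim (A.powSucc r).X ↔ ∃ u ∈ hodgeGroupOne A.dim A.X, diagPow A u r = U := by
  constructor
  · intro hU
    obtain ⟨g', hg', rfl⟩ := mem_hodgeGroupOne_iff.1 hU
    obtain ⟨u, hu, rfl⟩ := exists_mem_hodgeGroupOne_of_mem_hodgeGroup_powSucc A r hg'
    exact ⟨u, hu, (exteriorPullbackEquiv_one_eq _ _).symm⟩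
  · rintro ⟨u, hu, rfl⟩
    exact mem_hodgeGroupOne_iff.2 ⟨_, diagPowExterior_mem_hodgeGroup_powSucc A r hu, exteriorPullbackEquiv_one_eq _ _⟩

end MoonenZarhin

end Literature.AlgebraicGeometry.Milne1999

end
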